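import Mathlib
import HarnessLib
import Summits.HubbardSuperconductivity.HubbardSuperconductivity.Theorems.KLProgrammeKLRegimeEngineSliceIncrementFlow
import Summits.HubbardSuperconductivity.HubbardSuperconductivity.Theorems.KLProgrammeKLRegimeSplitFlowPieceOscJets

/-!
# KL programme — K3 ENGINE child (`KLRegimeEngineV17F2`, stmt-HubbardSuperconductivity-20437), stub (b) weighted lines, cure (c-D) in the (K5′) MEAN-FREE
# ORGANISATION: the `m`-th increment of the weighted slice pair sums along the MEAN-FREE flow chain `K̊_m = K_m ⊖ s_m` at a shifted level `μ′`

Cell `gate-hubbard-kl`, seat hubbard-kl-k3c3-p2 (g9); token #19 (K5′) «mean-free split» (pen (R59ax)/(R59bg), E1-WORD10 (W3), (Q-E1′)/(Q-CD) = YES).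
The δμ constants `klAngularMean ν_m` of the flow pieces are an exact LEVEL SHIFT (`…SplitFlowPieceOscJets.frameLevel_klFlowFrameU_eq_shift`: the band of
`K_n` at level `μ` is the band of `K̊_n := K_n ⊖ s_n`, `s_n = −Σ_{m<n} klAngularMean ν_m`, at level `μ + s_n`), so the (c-D) telescoping runs along the
mean-free chain `m ↦ K̊_m` at the FIXED level `μ′ = μ + s_n`: `K̊_{m+1} − K̊_m = −r_m` with the MEAN-FREE tail `r_m = p_m − klAngularMean ν_m`, whose order-0 size is
`FlowPieceOscAt L M c″ β U μ m`'s `c″·U²·4^{−2m}` — `U²` CURRENCY — and whose derivatives are the registered `FlowPieceJetsAt` jets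
(`FlowPieceOscAt.pieceClause`); the band of `K̊_m` at any level has the derivatives of the band of `K_m` (`flowFrame_band_data`).  Hence the twin of
`…EngineSliceIncrementFlow.sliceIncrPairWt_flow_le` with **`G₀ = c″·|U|·uPow 0 U = c″U²`** in place of `Gfr₀·uPow 0 U`:

* **`sliceIncrPairWt_flowOsc_le`** — for the pair `(K̊_m, K̊_{m+1})` at ANY level `μ′`:
  `Σ_z (1 + s₀|t| + (ρ/4^m)(|x₀|+|x₁|))·‖Ŝ^Δ_m(z)‖ ≤ 4^m·Π̂·√(24·2M·L²N_s)·2c₀K₁·c″U²/16^m` — so the rate `ρ` (from `G₃ρ³ ≤ (2/π)³G₀`) is `U`-FREE and the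
  per-piece cost after weight comparison is `∝ U²`, `m`-free: `θ_j = c·U²·2^{−3j/2}`, E1's (W3) law from the (c-D) side.

Everything is proved; no definitions, no sorry.  Nothing asserts superconductivity.
-/

noncomputable section

namespace Summit.HubbardSuperconductivity.HubbardSuperconductivity.Theorems.EngineV8

set_option linter.dupNamespace false -- summit = problem name (single-conjunct summit), D-0017

open Real Finset Literature.MathematicalPhysics.QuantumLattice Literature.Probability.LatticeModels
open Summit.HubbardSuperconductivity.HubbardSuperconductivity.Theorems.DispersionFlow
open Summit.HubbardSuperconductivity.HubbardSuperconductivity.Theorems.KLRegimeSplit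
open Summit.HubbardSuperconductivity.HubbardSuperconductivity.Theorems.TorusFourierL2

/-! ## The increment along the mean-free chain -/

variable {L M : ℕ} [NeZero L] [NeZero M]

/-- **The `m`-th weighted slice pair increment along the MEAN-FREE flow chain at level `μ′`** (see the module docstring): the two-scale class with
`G₀ = c″·|U|·uPow 0 U` (order 0 from `FlowPieceOscAt`), `G_i = Gfr_i·uPow_i U` (`i ≥ 1`, `FlowPieceJetsAt`), band data of `K_m`.
[cite: BenfattoGiulianiMastropietro2006, §3 (3.2)–(3.8)] -/
theorem sliceIncrPairWt_flowOsc_le {β U μ μ' Λ Λ' c'' : ℝ} {R : RenConsts} {m : ℕ} (hβ : 0 < β) (hΛ : 0 < Λ) (hΛΛ' : Λ ≤ Λ')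
    (hM : Λ' < π * (2 * M - 5) / β) (hR : ∀ j, 0 ≤ R.Gfr j) (hJ : ∀ m' ≤ m, FlowPieceJetsAt L M β U μ R m')
    (hO : FlowPieceOscAt L M c'' β U μ m)
    {G₀ G₁ G₂ G₃ b₁ b₂ b₂' b₃ b₃' : ℝ} (hG₀ : G₀ = c'' * |U| * uPow 0 U) (hG₁ : G₁ = R.Gfr 1 * uPow 1 U) (hG₂ : G₂ = R.Gfr 2 * uPow 2 U)
    (hG₃ : G₃ = R.Gfr 3 * uPow 3 U) (hb₁ : b₁ = 4 + 4 / 3 * (R.Gfr 1 * uPow 1 U)) (hb₂ : b₂ = 16) (hb₂' : b₂' = R.Gfr 2 * uPow 2 U)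
    (hb₃ : b₃ = 64) (hb₃' : b₃' = R.Gfr 3 * uPow 3 U / 3)
    {B₁ B₂ B₃ B₄ : ℝ} (hB₁ : ∀ x, |deriv salmhoferCutoff x| ≤ B₁) (hB₂ : ∀ x, |deriv (deriv salmhoferCutoff) x| ≤ B₂)
    (hB₃ : ∀ x, |deriv (deriv (deriv salmhoferCutoff)) x| ≤ B₃) (hB₄ : ∀ x, |deriv (deriv (deriv (deriv salmhoferCutoff))) x| ≤ B₄)
    (Mf : TorusSite 1 (2 * M) × TorusSite 2 L → ℂ) (hM0 : ∀ q, ‖Mf q‖ ≤ 1) {Ns : ℕ} (hsupp : (univ.filter fun q => Mf q ≠ 0).card ≤ Ns)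
    (v : Fin 2 → ℤ) (hv : v ≠ 0)
    {at₁ at₂ at₃ : ℝ} (hat₁ : 0 ≤ at₁) (hat₂ : 0 ≤ at₂) (hat₃ : 0 ≤ at₃)
    (hMt₁ : ∀ q, ‖fwdDiff ((fun _ : Fin 1 => (1 : ZMod (2 * M))), (0 : TorusSite 2 L)) Mf q‖ ≤ at₁)
    (hMt₂ : ∀ q, ‖(fwdDiff ((fun _ : Fin 1 => (1 : ZMod (2 * M))), (0 : TorusSite 2 L)))^[2] Mf q‖ ≤ at₂)
    (hMt₃ : ∀ q, ‖(fwdDiff ((fun _ : Fin 1 => (1 : ZMod (2 * M))), (0 : TorusSite 2 L)))^[3] Mf q‖ ≤ at₃)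
    {α₁ α₂ α₃ : ℝ} (hα₁ : 0 ≤ α₁) (hα₂ : 0 ≤ α₂) (hα₃ : 0 ≤ α₃)
    (hMe₁ : ∀ q (i : Fin 2), ‖fwdDiff ((0 : TorusSite 1 (2 * M)), (Pi.single i (1 : ZMod L) : TorusSite 2 L)) Mf q‖ ≤
      α₁ * ‖(WithLp.toLp 2 (fun j => 2 * π / L * ((Pi.single i (1 : ℤ) : Fin 2 → ℤ) j : ℝ)) : EuclideanSpace ℝ (Fin 2))‖)
    (hMe₂ : ∀ q (i : Fin 2), ‖(fwdDiff ((0 : TorusSite 1 (2 * M)), (Pi.single i (1 : ZMod L) : TorusSite 2 L)))^[2] Mf q‖ ≤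
      α₂ * ‖(WithLp.toLp 2 (fun j => 2 * π / L * ((Pi.single i (1 : ℤ) : Fin 2 → ℤ) j : ℝ)) : EuclideanSpace ℝ (Fin 2))‖ ^ 2)
    (hMe₃ : ∀ q (i : Fin 2), ‖(fwdDiff ((0 : TorusSite 1 (2 * M)), (Pi.single i (1 : ZMod L) : TorusSite 2 L)))^[3] Mf q‖ ≤
      α₃ * ‖(WithLp.toLp 2 (fun j => 2 * π / L * ((Pi.single i (1 : ℤ) : Fin 2 → ℤ) j : ℝ)) : EuclideanSpace ℝ (Fin 2))‖ ^ 3)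
    (hMn₁ : ∀ q, ‖fwdDiff ((0 : TorusSite 1 (2 * M)), (fun j => ((![-v 1, v 0] j : ℤ) : ZMod L))) Mf q‖ ≤
      α₁ * ‖(WithLp.toLp 2 (fun j => 2 * π / L * ((![-v 1, v 0] : Fin 2 → ℤ) j : ℝ)) : EuclideanSpace ℝ (Fin 2))‖)
    (hMn₂ : ∀ q, ‖(fwdDiff ((0 : TorusSite 1 (2 * M)), (fun j => ((![-v 1, v 0] j : ℤ) : ZMod L))))^[2] Mf q‖ ≤
      α₂ * ‖(WithLp.toLp 2 (fun j => 2 * π / L * ((![-v 1, v 0] : Fin 2 → ℤ) j : ℝ)) : EuclideanSpace ℝ (Fin 2))‖ ^ 2)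
    (hMn₃ : ∀ q, ‖(fwdDiff ((0 : TorusSite 1 (2 * M)), (fun j => ((![-v 1, v 0] j : ℤ) : ZMod L))))^[3] Mf q‖ ≤
      α₃ * ‖(WithLp.toLp 2 (fun j => 2 * π / L * ((![-v 1, v 0] : Fin 2 → ℤ) j : ℝ)) : EuclideanSpace ℝ (Fin 2))‖ ^ 3)
    (hMv₁ : ∀ q, ‖fwdDiff ((0 : TorusSite 1 (2 * M)), (fun j => ((v j : ℤ) : ZMod L))) Mf q‖ ≤
      α₁ * ‖(WithLp.toLp 2 (fun j => 2 * π / L * (v j : ℝ)) : EuclideanSpace ℝ (Fin 2))‖)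
    (hMv₂ : ∀ q, ‖(fwdDiff ((0 : TorusSite 1 (2 * M)), (fun j => ((v j : ℤ) : ZMod L))))^[2] Mf q‖ ≤
      α₂ * ‖(WithLp.toLp 2 (fun j => 2 * π / L * (v j : ℝ)) : EuclideanSpace ℝ (Fin 2))‖ ^ 2)
    (hMv₃ : ∀ q, ‖(fwdDiff ((0 : TorusSite 1 (2 * M)), (fun j => ((v j : ℤ) : ZMod L))))^[3] Mf q‖ ≤
      α₃ * ‖(WithLp.toLp 2 (fun j => 2 * π / L * (v j : ℝ)) : EuclideanSpace ℝ (Fin 2))‖ ^ 3)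
    {s₀ ρ ρ₃ k₁ k₂ k₃ k₄ : ℝ} (hs₀ : 0 < s₀) (hρ : 0 < ρ) (hρ₃ : 0 < ρ₃)
    (hk₁ : k₁ = (16 * B₁ + 16) / Λ ^ 2) (hk₂ : k₂ = (32 * B₂ + 144 * B₁ + 128) / Λ ^ 3)
    (hk₃ : k₃ = (64 * B₃ + 480 * B₂ + 1728 * B₁ + 1536) / Λ ^ 4)
    (hk₄ : k₄ = (128 * B₄ + 1408 * B₃ + 7776 * B₂ + 27648 * B₁ + 24576) / Λ ^ 5)
    (ht : (2 * π / β) ^ 3 * ((128 * B₄ + 1216 * B₃ + 6912 * B₂ + 26112 * B₁ + 24576) * (β * (L : ℝ) ^ 2) / Λ ^ 5) +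
          3 * (at₁ * ((2 * π / β) ^ 2 * ((64 * B₃ + 416 * B₂ + 1600 * B₁ + 1536) * (β * (L : ℝ) ^ 2) / Λ ^ 4))) +
          3 * (at₂ * ((2 * π / β) * ((32 * B₂ + 128 * B₁ + 128) * (β * (L : ℝ) ^ 2) / Λ ^ 3))) + at₃ * ((16 * B₁ + 16) * (β * (L : ℝ) ^ 2) / Λ ^ 2) ≤
      2 * ((16 * B₁ + 16) * (β * (L : ℝ) ^ 2) / Λ ^ 2) * (4 / (s₀ * (2 * M : ℕ))) ^ 3)
    (hX1 : 3 * (3 * G₁ * k₂ * b₂' + 3 * G₂ * k₁ * α₁ + 3 * G₂ * k₂ * b₁) ≤ k₁ * G₃ * (4 : ℝ) ^ m)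
    (hX2 : 3 * (3 * G₀ * k₂ * α₁ * b₂' + 3 * G₀ * k₃ * b₁ * b₂' + 6 * G₁ * k₂ * α₁ * b₁ + 3 * G₁ * k₃ * b₁ ^ 2 + G₀ * G₃ * k₂ + G₀ * k₂ * b₃' + 3 * G₁ * G₂ * k₂ + 3 * G₁ * k₁ * α₂ + 3 * G₁ * k₂ * b₂) ≤ k₁ * G₃ * ((4 : ℝ) ^ m) ^ 2)
    (hX3 : 3 * ((3 * G₀ * k₃ * α₁ * b₁ ^ 2 + G₀ * k₄ * b₁ ^ 3 + 3 * G₀ * G₁ * k₃ * b₂' + 3 * G₀ * G₂ * k₂ * α₁ + 3 * G₀ * G₂ * k₃ * b₁ + 3 * G₀ * k₂ * α₁ * b₂ + 3 * G₀ * k₂ * α₂ * b₁ + 3 * G₀ * k₃ * b₁ * b₂ + 3 * G₁ ^ 2 * k₂ * α₁ + 3 * G₁ ^ 2 * k₃ * b₁ + G₀ * k₁ * α₃ + G₀ * k₂ * b₃) + (6 * G₀ * G₁ * k₃ * α₁ * b₁ + 3 * G₀ * G₁ * k₄ * b₁ ^ 2 + 3 * G₀ * G₁ * G₂ * k₃ +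 3 * G₀ * G₁ * k₂ * α₂ + 3 * G₀ * G₁ * k₃ * b₂ + G₁ ^ 3 * k₃) + (3 * G₀ * G₁ ^ 2 * k₃ * α₁ + 3 * G₀ * G₁ ^ 2 * k₄ * b₁) + (G₀ * G₁ ^ 3 * k₄)) ≤
      k₁ * G₃ * ((4 : ℝ) ^ m) ^ 3)
    (hY1 : 2 * (G₀ * k₂ * b₂' + 2 * G₁ * k₁ * α₁ + 2 * G₁ * k₂ * b₁) ≤ k₁ * G₂ * (4 : ℝ) ^ m)
    (hY2 : 2 * ((2 * G₀ * k₂ * α₁ * b₁ + G₀ * k₃ * b₁ ^ 2 + G₀ * G₂ * k₂ + G₀ * k₁ * α₂ + G₀ * k₂ * b₂ + G₁ ^ 2 * k₂) + (2 * G₀ * G₁ * k₂ * α₁ + 2 * G₀ * G₁ * k₃ * b₁) + (G₀ * G₁ ^ 2 * k₃)) ≤ k₁ * G₂ * ((4 : ℝ) ^ m) ^ 2)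
    (hrate₃ : G₃ * ρ ^ 3 ≤ (2 / π) ^ 3 * G₀) (hrate₂ : G₂ * ρ₃ ^ 2 ≤ (2 / π) ^ 2 * G₀) :
    ∑ z : TorusSite 1 (2 * M) × TorusSite 2 L,
        (1 + s₀ * |(((z.1 0).valMinAbs : ℤ) : ℝ)| + ρ / (4 : ℝ) ^ m * |(((z.2 0).valMinAbs : ℤ) : ℝ)| + ρ / (4 : ℝ) ^ m * |(((z.2 1).valMinAbs : ℤ) : ℝ)|) *
        ‖∑ q : TorusSite 1 (2 * M) × TorusSite 2 L, (torusChar q.1 z.1 * torusChar q.2 z.2) •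
          ((((1 / (β * (L : ℝ) ^ 2) : ℝ) : ℂ) ^ 2 *
            (Mf q * (sliceSymbolFnXi (β * (L : ℝ) ^ 2) 0 Λ Λ' (matsubaraFreq β M ⟨(q.1 0).val, ZMod.val_lt (q.1 0)⟩)
                (nambuXiCT L μ' (fsub (klFlowFrameU L M β U μ (m + 1)) (symInterp L fun _ => -(∑ m' ∈ range (m + 1), klAngularMean (klLocalPart L M β U μ (klFlowFrameU L M β U μ m') m')))) q.2) -
              sliceSymbolFnXi (β * (L : ℝ) ^ 2) 0 Λ Λ' (matsubaraFreq β M ⟨(q.1 0).val, ZMod.val_lt (q.1 0)⟩)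
                (nambuXiCT L μ' (fsub (klFlowFrameU L M β U μ m) (symInterp L fun _ => -(∑ m' ∈ range m, klAngularMean (klLocalPart L M β U μ (klFlowFrameU L M β U μ m') m')))) q.2)))))‖ ≤
      (4 : ℝ) ^ m * Real.sqrt (524288 * (1 / s₀ + 1) * ((1 + 4 * Real.sqrt 2) ^ 2 * ((2 * Real.sqrt 2 / ρ + 2) * (2 * Real.sqrt 2 / ρ₃ + 2)) + (1 / ρ + 1) ^ 2)) *
        Real.sqrt (24 * (2 * M : ℕ) * (L : ℝ) ^ 2 * Ns) * (2 * ((1 / (β * (L : ℝ) ^ 2)) ^ 2 * ((16 * B₁ + 16) * (β * (L : ℝ) ^ 2) / Λ ^ 2 * (G₀ / ((4 : ℝ) ^ m) ^ 2)))) := by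
  have hx : (1 : ℝ) ≤ (4 : ℝ) ^ m := one_le_pow₀ (by norm_num)
  have hu : ∀ j, 0 ≤ uPow j U := fun j => by unfold uPow; split_ifs <;> positivity
  -- the increment along the mean-free chain is the mean-free tail `r_m`
  have hinc : (fun q : Momentum => frameLevel μ' (fsub (klFlowFrameU L M β U μ (m + 1)) (symInterp L fun _ => -(∑ m' ∈ range (m + 1), klAngularMean (klLocalPart L M β U μ (klFlowFrameU L M β U μ m') m')))) q -
      frameLevel μ' (fsub (klFlowFrameU L M β U μ m) (symInterp L fun _ => -(∑ m' ∈ range m, klAngularMean (klLocalPart L M β U μ (klFlowFrameU L M β U μ m') m')))) q) =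
      fun q => evalM (klFlowPiece L M β U μ m) q - klAngularMean (klLocalPart L M β U μ (klFlowFrameU L M β U μ m) m) := by
    funext q
    rw [frameLevel_eq_zero_sub_evalM μ' (fsub (klFlowFrameU L M β U μ (m + 1)) (symInterp L fun _ => -(∑ m' ∈ range (m + 1), klAngularMean (klLocalPart L M β U μ (klFlowFrameU L M β U μ m') m')))),
      frameLevel_eq_zero_sub_evalM μ' (fsub (klFlowFrameU L M β U μ m) (symInterp L fun _ => -(∑ m' ∈ range m, klAngularMean (klLocalPart L M β U μ (klFlowFrameU L M β U μ m') m')))), evalM_fsub, evalM_fsub, klFlowFrameU_succ, evalM_fsub,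
      Finset.sum_range_succ]
    simp only [evalM_symInterp_const]
    ring
  have hP : ∀ j ≤ 4, ∀ q : Momentum, ‖iteratedFDeriv ℝ j (fun q : Momentum => frameLevel μ' (fsub (klFlowFrameU L M β U μ (m + 1)) (symInterp L fun _ => -(∑ m' ∈ range (m + 1), klAngularMean (klLocalPart L M β U μ (klFlowFrameU L M β U μ m') m')))) q -
      frameLevel μ' (fsub (klFlowFrameU L M β U μ m) (symInterp L fun _ => -(∑ m' ∈ range m, klAngularMean (klLocalPart L M β U μ (klFlowFrameU L M β U μ m') m')))) q) q‖ ≤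
      (if j = 0 then c'' * |U| else R.Gfr j) * uPow j U * (4 : ℝ) ^ (((j : ℤ) - 2) * (m : ℤ)) := fun j hj q => by
    rw [hinc]; exact hO.pieceClause (hJ m le_rfl) hj q
  have e0 : (4 : ℝ) ^ (((0 : ℤ) - 2) * (m : ℤ)) = 1 / ((4 : ℝ) ^ m) ^ 2 := by
    rw [zero_sub, show (-2 : ℤ) * (m : ℤ) = -((m * 2 : ℕ) : ℤ) by push_cast; ring, zpow_neg, zpow_natCast, pow_mul, one_div]
  have e1 : (4 : ℝ) ^ (((1 : ℤ) - 2) * (m : ℤ)) = 1 / (4 : ℝ) ^ m := by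
    rw [show ((1 : ℤ) - 2) * (m : ℤ) = -(m : ℤ) by ring, zpow_neg, zpow_natCast, one_div]
  have e2 : (4 : ℝ) ^ (((2 : ℤ) - 2) * (m : ℤ)) = 1 := by rw [sub_self, zero_mul, zpow_zero]
  have e3 : (4 : ℝ) ^ (((3 : ℤ) - 2) * (m : ℤ)) = (4 : ℝ) ^ m := by
    rw [show ((3 : ℤ) - 2) * (m : ℤ) = (m : ℤ) by ring, zpow_natCast]
  have hv₀' : ∀ p : Momentum, |frameLevel μ' (fsub (klFlowFrameU L M β U μ (m + 1)) (symInterp L fun _ => -(∑ m' ∈ range (m + 1), klAngularMean (klLocalPart L M β U μ (klFlowFrameU L M β U μ m') m')))) p -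
      frameLevel μ' (fsub (klFlowFrameU L M β U μ m) (symInterp L fun _ => -(∑ m' ∈ range m, klAngularMean (klLocalPart L M β U μ (klFlowFrameU L M β U μ m') m')))) p| ≤ G₀ / ((4 : ℝ) ^ m) ^ 2 := fun p => by
    have h := hP 0 (by norm_num) p
    rw [norm_iteratedFDeriv_zero, Real.norm_eq_abs, if_pos rfl, Nat.cast_zero, e0] at h
    refine h.trans_eq ?_
    rw [hG₀]; ring
  have hv₁' : ∀ p : Momentum, ‖fderiv ℝ (fun q : Momentum => frameLevel μ' (fsub (klFlowFrameU L M β U μ (m + 1)) (symInterp L fun _ => -(∑ m' ∈ range (m + 1), klAngularMean (klLocalPart L M β U μ (klFlowFrameU L M β U μ m') m')))) q -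
      frameLevel μ' (fsub (klFlowFrameU L M β U μ m) (symInterp L fun _ => -(∑ m' ∈ range m, klAngularMean (klLocalPart L M β U μ (klFlowFrameU L M β U μ m') m')))) q) p‖ ≤ G₁ / (4 : ℝ) ^ m := fun p => by
    have h := hP 1 (by norm_num) p
    rw [norm_iteratedFDeriv_one, if_neg one_ne_zero, Nat.cast_one, e1] at h
    refine h.trans_eq ?_
    rw [hG₁]; ring
  have hv₂' : ∀ p : Momentum, ‖iteratedFDeriv ℝ 2 (fun q : Momentum => frameLevel μ' (fsub (klFlowFrameU L M β U μ (m + 1)) (symInterp L fun _ => -(∑ m' ∈ range (m + 1), klAngularMean (klLocalPart L M β U μ (klFlowFrameU L M β U μ m') m')))) q -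
      frameLevel μ' (fsub (klFlowFrameU L M β U μ m) (symInterp L fun _ => -(∑ m' ∈ range m, klAngularMean (klLocalPart L M β U μ (klFlowFrameU L M β U μ m') m')))) q) p‖ ≤ G₂ := fun p => by
    have h := hP 2 (by norm_num) p
    rw [if_neg two_ne_zero, Nat.cast_ofNat, e2, mul_one] at h
    refine h.trans_eq ?_
    rw [hG₂]
  have hv₃' : ∀ p : Momentum, ‖iteratedFDeriv ℝ 3 (fun q : Momentum => frameLevel μ' (fsub (klFlowFrameU L M β U μ (m + 1)) (symInterp L fun _ => -(∑ m' ∈ range (m + 1), klAngularMean (klLocalPart L M β U μ (klFlowFrameU L M β U μ m') m')))) q -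
      frameLevel μ' (fsub (klFlowFrameU L M β U μ m) (symInterp L fun _ => -(∑ m' ∈ range m, klAngularMean (klLocalPart L M β U μ (klFlowFrameU L M β U μ m') m')))) q) p‖ ≤ G₃ * (4 : ℝ) ^ m := fun p => by
    have h := hP 3 (by norm_num) p
    rw [if_neg (by norm_num : (3 : ℕ) ≠ 0), Nat.cast_ofNat, e3] at h
    refine h.trans_eq ?_
    rw [hG₃]
  -- the band of `K̊_m` at level `μ′` is the band of `K_m` at a shifted level: same derivatives
  have hlev : frameLevel μ' (fsub (klFlowFrameU L M β U μ m) (symInterp L fun _ => -(∑ m' ∈ range m, klAngularMean (klLocalPart L M β U μ (klFlowFrameU L M β U μ m') m')))) =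
      frameLevel (μ' + (∑ m' ∈ range m, klAngularMean (klLocalPart L M β U μ (klFlowFrameU L M β U μ m') m'))) (klFlowFrameU L M β U μ m) :=
    frameLevel_of_eval_eq_add_const fun p => by rw [eval_fsub_symInterp_const]; ring
  have hlev' : ∀ (ν : ℝ) (i : ℕ), i ≠ 0 → ∀ q : Momentum,
      iteratedFDeriv ℝ i (frameLevel ν (klFlowFrameU L M β U μ m)) q = iteratedFDeriv ℝ i (frameLevel μ (klFlowFrameU L M β U μ m)) q := by
    intro ν i hi q
    have e : frameLevel ν (klFlowFrameU L M β U μ m) = fun q => frameLevel μ (klFlowFrameU L M β U μ m) q + (fun _ : Momentum => μ - ν) q := by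
      funext q; simp only [frameLevel]; ring
    rw [e, fun_iteratedFDeriv_add_apply (contDiff_frameLevel μ _).contDiffAt contDiffAt_const, iteratedFDeriv_const_of_ne hi,
      Pi.zero_apply, add_zero]
  obtain ⟨hd₁, hd₂, hd₃⟩ := flowFrame_band_data (L := L) (M := M) (β := β) (U := U) (μ := μ) (R := R) (m := m)
    (fun m' hm' => hJ m' hm'.le)
  have hb₁' : ∀ p : Momentum, ‖fderiv ℝ (frameLevel μ' (fsub (klFlowFrameU L M β U μ m) (symInterp L fun _ => -(∑ m' ∈ range m, klAngularMean (klLocalPart L M β U μ (klFlowFrameU L M β U μ m') m'))))) p‖ ≤ b₁ := fun p => by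
    rw [← norm_iteratedFDeriv_one, hlev, hlev' _ 1 one_ne_zero, norm_iteratedFDeriv_one]
    exact (hd₁ p).trans (by rw [hb₁, pow_one]; exact add_le_add le_rfl (sum_jet_one_le (hR 1) (hu 1) m))
  have hb₂'' : ∀ p : Momentum, ‖iteratedFDeriv ℝ 2 (frameLevel μ' (fsub (klFlowFrameU L M β U μ m) (symInterp L fun _ => -(∑ m' ∈ range m, klAngularMean (klLocalPart L M β U μ (klFlowFrameU L M β U μ m') m'))))) p‖ ≤ b₂ + b₂' * (4 : ℝ) ^ m := fun p => by
    rw [hlev, hlev' _ 2 two_ne_zero]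
    exact (hd₂ p).trans (by
      rw [hb₂, hb₂', show ((4 : ℝ) ^ (2 : ℕ)) = 16 by norm_num]
      exact add_le_add le_rfl (sum_jet_two_le (hR 2) (hu 2) m))
  have hb₃'' : ∀ p : Momentum, ‖iteratedFDeriv ℝ 3 (frameLevel μ' (fsub (klFlowFrameU L M β U μ m) (symInterp L fun _ => -(∑ m' ∈ range m, klAngularMean (klLocalPart L M β U μ (klFlowFrameU L M β U μ m') m'))))) p‖ ≤ b₃ + b₃' * (4 : ℝ) ^ m := fun p => by
    rw [hlev, hlev' _ 3 (by norm_num)]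
    exact (hd₃ p).trans (by
      rw [hb₃, hb₃', show ((4 : ℝ) ^ (3 : ℕ)) = 64 by norm_num]
      exact add_le_add le_rfl (sum_jet_three_le (hR 3) (hu 3) m))
  have hG₂0 : 0 ≤ G₂ := by rw [hG₂]; exact mul_nonneg (hR 2) (hu 2)
  have hG₃0 : 0 ≤ G₃ := by rw [hG₃]; exact mul_nonneg (hR 3) (hu 3)
  have hb₂0 : 0 ≤ b₂ := by rw [hb₂]; norm_num
  have hb₂'0 : 0 ≤ b₂' := by rw [hb₂']; exact mul_nonneg (hR 2) (hu 2)
  have hb₃0 : 0 ≤ b₃ := by rw [hb₃]; norm_num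
  have hb₃'0 : 0 ≤ b₃' := by rw [hb₃']; exact div_nonneg (mul_nonneg (hR 3) (hu 3)) (by norm_num)
  exact sliceIncrPairWt_charSum_l1_le_twoScale hβ hΛ hΛΛ' hM hx hG₂0 hG₃0 hb₂0 hb₂'0 hb₃0 hb₃'0 hb₁' hb₂'' hb₃'' hv₀' hv₁' hv₂' hv₃'
    hB₁ hB₂ hB₃ hB₄ Mf hM0 hsupp v hv hat₁ hat₂ hat₃ hMt₁ hMt₂ hMt₃ hα₁ hα₂ hα₃ hMe₁ hMe₂ hMe₃ hMn₁ hMn₂ hMn₃ hMv₁ hMv₂ hMv₃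
    hs₀ hρ hρ₃ hk₁ hk₂ hk₃ hk₄ ht hX1 hX2 hX3 hY1 hY2 hrate₃ hrate₂

end Summit.HubbardSuperconductivity.HubbardSuperconductivity.Theorems.EngineV8

end
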